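import Summits.QuantumFields.BalabanUV.Beta.GAN24.Lin4SlotDivergence
import Summits.QuantumFields.BalabanUV.Beta.KernelWardResponse
import Summits.QuantumFields.BalabanUV.Beta.BubbleParity

/-!
# `BalabanUV.Beta.GAN24.Lin4LegDivergence` — binder row G-an2-4 ∕ (CONV-C), CT-W (route WC-TL): «T-EQ» FOR THE TWO KERNEL LEGS OF THE LINEAR STEP
# `lin4` — the coarse divergence of a kernel leg of `lin4 c K N T` is `−(c·c_H) ×` the block sum of the fine backward divergence of the corresponding
# FIELD leg of the resolvent-dressed symmetrised bi-vertex (G-an2-4 formalisation swarm, leaf prover `b2b-balaban-gan24-formalise-leaf-03`, gen 58;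
# the OWNER gan24-p1 g24's W10 «INTENT 3 GO, YOURS»; module name PROVISIONAL)

NOT IN PRINT; OUR BOOKKEEPING.  HONEST FRAMING (cell contract, verbatim): «discharging `BetaPertH` makes Bałaban's UV stability
UNCONDITIONAL — a real constructive-QFT result; it is NOT the continuum limit and NOT the Clay problem.»  HONEST DEPENDENCY (verbatim):
«continuum YM on T⁴ ⇐ BetaPertH ∧ nine spine estimates (0/9 proved); BetaPertH ⇐ (D1) ∧ (D4) ∧ CAP+tail; G-an2-4 gates asym, D1 and
NE2/3/4.»

WHAT ([folklore] kernel algebra on leaf-01's bounded-table class; the output legs of leaf-04's `lin4` are the MULTIPLIER legs of the resolvent sandwich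
`K ∘ vsym K N T κ u κ′ u′ ∘ K` read at coarse points, `mmRead_inl_inl`; an1's ROW LAW OF A RIGHT SANDWICH `KernelWardResponse.row_comp_ward` is the engine;
0 `def`, 0 cite, 0 `def … : Prop`, 0 sorry):
* §1 `row_comp_ward_of_bdd` (an1's `row_comp_ward` with the decay on the OTHER factor: `A` bounded, `K` decaying — the class of `K ∘ vsym T` for a bounded
  table), `tsum_mul_gaugeWt_eq_boxSum` (the pure-gauge pairing of a scalar leg function = the BLOCK SUM of its fine backward divergence; an1's
  `wsum_blockInd(_shift)` read on scalars).
* §2 **`legDiv_lin4_right`** (decaying `K` with (hH) constant `c_H` and (hM♯), `N ≥ 1`, bounded `T`, any `c`):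
  `Σ_β (lin4 … x′ (y − e_β) (inl α) (inl β) − lin4 … x′ y (inl α) (inl β)) = −(c·c_H) · Σ_{v∈box} Σ_{κ₂} Δ^{fine}_{κ₂} (K ∘ vsym K N T κ u κ′ u′)(N•x′, N•y + toSite v; inr α, inl κ₂)`
  — the RIGHT resolvent factor REPLACED by the block sum over `B(y)` of the fine divergence of the right FIELD leg of `K ∘ vsym T`; `legDiv_lin4_right_inner`
  (the left `K` pulled out of the block sum: slices summable).  §2b `comp_assoc_dbd`, **`legDiv_lin4_left`** — the mirror statement through the
  transpose `trK` (laws (hH′), (hM♯′) for `trK K` displayed).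
* §3 THE COMB ∕ WALL INSTANCE `K♮ᴱ_j := unitK (sfStep Lc j) (smStep d Lc j) (coDressKBmAt (toSite r) Lc (KInvStep Lc j))`, `N := Lc`, every `j`, every in-block
  root: `hM_unitK_comb` ((hM♯) from an1's `rowM_ward_coDressKBmAt_KInvStep`), `hH_trK_unitK_comb` ∕ `hM_trK_unitK_comb` (the transposed laws from
  `BubbleParity.trK_coDressKBmAt_KInvStep`: `trK G_j = sgnK G_j`, so `c_H′ = −c_H = −(Lc^{d+1})⁻¹` — the OWNER's R7 (E0) «opposite sign»),
  **`legDiv_lin4_right_comb`**, **`legDiv_lin4_left_comb`** ((hH) itself is `Lin4SlotDivergence.hH_unitK_comb`).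
Asserts NO shape or rate of Bałaban's tables; decides nothing about CT-W-DESIGN-v2 ∕ Q-gan24p1-g24-1 (whether the leg storey is slaved) by itself;
discharges NOTHING of «T2Shape» ∕ «T2Drift» ∕ (hW, hWall) ∕ (C) ∕ (Q-R); 0 wall binders; NEVER «G-an2-4 closed» as (CONV-C); NOT D1, NOT `BetaPertH`,
NOT continuum, NOT Clay; not in print.  Unit `b2b-balaban-gan24-formalise-leaf-03` (gen 58), 2026-08-22.
-/

noncomputable section

open Finset
open scoped BigOperators
open Literature.MathematicalPhysics.QuantumFieldTheory
open Literature.MathematicalPhysics.QuantumFieldTheory.Balaban1983to89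
open Literature.MathematicalPhysics.QuantumFieldTheory.Balaban1983to89.Beta
open B6BondElimination (unitVec)
open ExpKernelCalculus (MKer Site Decays comp summable_exp_shift')
open OneStepResolventKernel (Fib wsum)
open OneStepKernelFamily (colH vertexOfK KInvStep)
open BalabanStepJetsSucc (mmRead mmRead_inl_inl)
open KernelWard (Bdd)
open AffineAveraging (box toSite)
open AveragingContours (blk)
open Summit.QuantumFields.BalabanUV.Beta.KernelWardRelative (gaugeWt wsum_blockInd wsum_blockInd_shift)
open Summit.QuantumFields.BalabanUV.Beta.GAN24.T2RecursionAffine (vsym lin4 lin4_apply)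
open Summit.QuantumFields.BalabanUV.Beta.GAN24.Lin4Additive (abs_vsym_le summable_slices_decays_bdd)
open Summit.QuantumFields.BalabanUV.Beta.HessKerDressedUnits (unitK unitK_apply legScale_inl legScale_inr colH_unitK decays_unitK)
open Summit.QuantumFields.BalabanUV.Beta.GAN24.CombesThomas (sfStep smStep)
open Summit.QuantumFields.BalabanUV.Beta.BorderedHessian (stepScale sgnK sgnK_apply sgnF sgnF_inl sgnF_inr)
open Summit.QuantumFields.BalabanUV.Beta.AxialDressingRooted (coDressKBmAt one_le_of_neZero decays_coDressKBmAt_KInvStep)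
open Summit.QuantumFields.BalabanUV.Beta.KernelWardHColumnWall (colH_ward_KInvStep_all)
open Summit.QuantumFields.BalabanUV.Beta.KernelWardResponse (rowM_ward_coDressKBmAt_KInvStep)
open Summit.QuantumFields.BalabanUV.Beta.GAN24.Lin4SlotDivergence (hH_unitK_comb sfStep_mul_smStep)
open Summit.QuantumFields.BalabanUV.Beta.TameKernelCalculus (trK trK_apply trK_comp)
open Summit.QuantumFields.BalabanUV.Beta.BubbleParity (trK_coDressKBmAt_KInvStep)

namespace Summit.QuantumFields.BalabanUV.Beta.GAN24.Lin4LegDivergence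

variable {d N : ℕ}

/-! ## §1 The row law of a right sandwich on the bounded class; the pure-gauge pairing of a scalar leg function as a block sum -/

/-- [folklore] **ROW LAW OF A RIGHT SANDWICH, BOUNDED `A`, DECAYING `K`** — an1's `KernelWardResponse.row_comp_ward` with the decay on the other
factor, same statement: `Σ_μ Δ_μ (A ∘ K)(x, N•y; a, inr μ) = c_H · Σ′_{x₂} Σ_{κ₂} A x x₂ a (inl κ₂) · gaugeWt N y κ₂ x₂` under (hH), (hM♯). -/
theorem row_comp_ward_of_bdd {A K : MKer (d + 1) (Fib d)} {CA : ℝ} (hA : Bdd A CA) {CK δK : ℝ} (hK : Decays K CK δK) (hδK : 0 < δK) (cH : ℝ)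
    (hH : ∀ (y : Site (d + 1)) (κ : Fin (d + 1)) (u : Site (d + 1)),
      ∑ μ, (colH K N μ (y - unitVec μ) κ u - colH K N μ y κ u) = cH * gaugeWt N y κ u)
    (hMf : ∀ (y x₂ : Site (d + 1)) (ρ : Fin (d + 1)),
      ∑ μ, (K x₂ ((N : ℤ) • (y - unitVec μ)) (Sum.inr ρ) (Sum.inr μ) - K x₂ ((N : ℤ) • y) (Sum.inr ρ) (Sum.inr μ)) = 0)
    (x : Site (d + 1)) (a : Fib d) (y : Site (d + 1)) :
    ∑ μ, (comp A K x ((N : ℤ) • (y - unitVec μ)) a (Sum.inr μ) - comp A K x ((N : ℤ) • y) a (Sum.inr μ)) =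
      cH * ∑' x₂, ∑ κ₂, A x x₂ a (Sum.inl κ₂) * gaugeWt N y κ₂ x₂ := by
  have hCK : 0 ≤ CK := hK.nonneg (Sum.inl 0)
  have hCA : 0 ≤ CA := (abs_nonneg _).trans (hA x x a a)
  have hs : ∀ (z : Site (d + 1)) (b : Fib d), Summable fun x₂ => ∑ f₂, A x x₂ a f₂ * K x₂ z f₂ b := fun z b => by
    refine summable_sum fun f₂ _ => Summable.of_norm_bounded (((summable_exp_shift' hδK z).mul_left CK).mul_left CA) (fun x₂ => ?_)
    rw [Real.norm_eq_abs, abs_mul]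
    exact mul_le_mul (hA x x₂ a f₂) (hK x₂ z f₂ b) (abs_nonneg _) hCA
  have hs' : ∀ μ : Fin (d + 1), Summable fun x₂ => ∑ f₂, A x x₂ a f₂ *
      (K x₂ ((N : ℤ) • (y - unitVec μ)) f₂ (Sum.inr μ) - K x₂ ((N : ℤ) • y) f₂ (Sum.inr μ)) := fun μ =>
    ((hs ((N : ℤ) • (y - unitVec μ)) (Sum.inr μ)).sub (hs ((N : ℤ) • y) (Sum.inr μ))).congr fun x₂ => by
      rw [← Finset.sum_sub_distrib]
      exact Finset.sum_congr rfl fun f₂ _ => by ring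
  have e1 : ∀ μ : Fin (d + 1), comp A K x ((N : ℤ) • (y - unitVec μ)) a (Sum.inr μ) - comp A K x ((N : ℤ) • y) a (Sum.inr μ) =
      ∑' x₂, ∑ f₂, A x x₂ a f₂ * (K x₂ ((N : ℤ) • (y - unitVec μ)) f₂ (Sum.inr μ) - K x₂ ((N : ℤ) • y) f₂ (Sum.inr μ)) := by
    intro μ
    show (∑' x₂, ∑ f₂, A x x₂ a f₂ * K x₂ ((N : ℤ) • (y - unitVec μ)) f₂ (Sum.inr μ)) -
        (∑' x₂, ∑ f₂, A x x₂ a f₂ * K x₂ ((N : ℤ) • y) f₂ (Sum.inr μ)) = _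
    rw [← (hs ((N : ℤ) • (y - unitVec μ)) (Sum.inr μ)).tsum_sub (hs ((N : ℤ) • y) (Sum.inr μ))]
    refine tsum_congr fun x₂ => ?_
    rw [← Finset.sum_sub_distrib]
    exact Finset.sum_congr rfl fun f₂ _ => by ring
  simp only [e1]
  rw [← Summable.tsum_finsetSum (fun μ _ => hs' μ), ← tsum_mul_left]
  refine tsum_congr fun x₂ => ?_
  rw [Finset.sum_comm]
  simp only [← Finset.mul_sum]
  rw [Fintype.sum_sum_type]
  have eH : ∀ κ₂ : Fin (d + 1),
      ∑ μ, (K x₂ ((N : ℤ) • (y - unitVec μ)) (Sum.inl κ₂) (Sum.inr μ) - K x₂ ((N : ℤ) • y) (Sum.inl κ₂) (Sum.inr μ)) =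
        cH * gaugeWt N y κ₂ x₂ := fun κ₂ => hH y κ₂ x₂
  simp only [eH, hMf y x₂, mul_zero, Finset.sum_const_zero, add_zero]
  rw [Finset.mul_sum]
  exact Finset.sum_congr rfl fun κ₂ _ => by ring

/-- [folklore] **THE PURE-GAUGE PAIRING OF A SCALAR LEG FUNCTION IS THE BLOCK SUM OF ITS FINE BACKWARD DIVERGENCE** (`N ≥ 1`, any `g`; an1's
`wsum_blockInd(_shift)` read on scalars): `Σ′_u Σ_κ g κ u · gaugeWt N y κ u = Σ_{v ∈ box} Σ_κ (g κ (N•y + toSite v − e_κ) − g κ (N•y + toSite v))`. -/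
theorem tsum_mul_gaugeWt_eq_boxSum (hN : 1 ≤ N) (g : Fin (d + 1) → Site (d + 1) → ℝ) (y : Site (d + 1)) :
    ∑' u, ∑ κ, g κ u * gaugeWt N y κ u
      = ∑ v ∈ box (d + 1) N, ∑ κ, (g κ ((N : ℤ) • y + toSite v - unitVec κ) - g κ ((N : ℤ) • y + toSite v)) := by
  -- read an1's kernel-family identities on the constant-in-the-legs families `u ↦ (x z a b ↦ g κ u)`
  have h1 : ∀ κ : Fin (d + 1), (∑' u, (if blk N (u + unitVec κ) = y then (1 : ℝ) else 0) * g κ u)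
      = ∑ v ∈ box (d + 1) N, g κ ((N : ℤ) • y + toSite v - unitVec κ) := by
    intro κ
    have h := wsum_blockInd_shift hN y (unitVec κ) (fun u => fun _ _ _ _ => g κ u)
    have h' := congrFun (congrFun (congrFun (congrFun h 0) 0) (Sum.inl 0)) (Sum.inl 0)
    simpa only [OneStepResolventKernel.wsum, Finset.sum_apply] using h'
  have h2 : ∀ κ : Fin (d + 1), (∑' u, (if blk N u = y then (1 : ℝ) else 0) * g κ u)
      = ∑ v ∈ box (d + 1) N, g κ ((N : ℤ) • y + toSite v) := by
    intro κ
    have h := wsum_blockInd hN y (fun u => fun _ _ _ _ => g κ u)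
    have h' := congrFun (congrFun (congrFun (congrFun h 0) 0) (Sum.inl 0)) (Sum.inl 0)
    simpa only [OneStepResolventKernel.wsum, Finset.sum_apply] using h'
  have hs1 : ∀ κ : Fin (d + 1), Summable fun u => (if blk N (u + unitVec κ) = y then (1 : ℝ) else 0) * g κ u :=
    fun κ => KernelWardRelative.summable_blockInd_mul hN y (unitVec κ) (g κ)
  have hs2 : ∀ κ : Fin (d + 1), Summable fun u => (if blk N u = y then (1 : ℝ) else 0) * g κ u := fun κ => by
    simpa only [add_zero] using KernelWardRelative.summable_blockInd_mul hN y 0 (g κ)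
  have e : ∀ u, ∑ κ, g κ u * gaugeWt N y κ u
      = ∑ κ, ((if blk N (u + unitVec κ) = y then (1 : ℝ) else 0) * g κ u - (if blk N u = y then (1 : ℝ) else 0) * g κ u) := fun u =>
    Finset.sum_congr rfl fun κ _ => by simp only [gaugeWt]; ring
  simp only [e]
  rw [Summable.tsum_finsetSum (fun κ _ => (hs1 κ).sub (hs2 κ)), Finset.sum_comm]
  refine Finset.sum_congr rfl fun κ _ => ?_
  rw [(hs1 κ).tsum_sub (hs2 κ), h1 κ, h2 κ, ← Finset.sum_sub_distrib]

/-! ## §2 The coarse divergence of the right kernel leg of `lin4` -/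

section Lin

variable {K : MKer (d + 1) (Fib d)} {C δ : ℝ} {T : Fin (d + 1) → (Fin (d + 1) → ℤ) → Fin (d + 1) → (Fin (d + 1) → ℤ) → MKer (d + 1) (Fib d)}
  {B : ℝ} {cH : ℝ}

/-- [folklore] **T-EQ, RIGHT LEG SLOT**: for a decaying `K` (rate `δ > 0`) with (hH) (constant `c_H`) and (hM♯), `N ≥ 1`, a bounded bi-table `T`,
any `c`, every output row `(x′, α)` and coarse site `y`, the coarse divergence of the right kernel leg of `lin4 c K N T κ u κ′ u′` is `−(c·c_H) ×` the block
sum over `B(y)` of the fine backward divergence of the right FIELD leg of `K ∘ vsym K N T κ u κ′ u′` (the right resolvent factor is REPLACED). -/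
theorem legDiv_lin4_right (hK : Decays K C δ) (hδ : 0 < δ) (hN : 1 ≤ N) (c : ℝ) (hT : ∀ κ u κ' u' x z a b, |T κ u κ' u' x z a b| ≤ B)
    (hH : ∀ (y : Site (d + 1)) (κ : Fin (d + 1)) (u : Site (d + 1)),
      ∑ μ, (colH K N μ (y - unitVec μ) κ u - colH K N μ y κ u) = cH * gaugeWt N y κ u)
    (hMf : ∀ (y x₂ : Site (d + 1)) (ρ : Fin (d + 1)),
      ∑ μ, (K x₂ ((N : ℤ) • (y - unitVec μ)) (Sum.inr ρ) (Sum.inr μ) - K x₂ ((N : ℤ) • y) (Sum.inr ρ) (Sum.inr μ)) = 0)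
    (κ : Fin (d + 1)) (u : Site (d + 1)) (κ' : Fin (d + 1)) (u' : Site (d + 1)) (x' : Site (d + 1)) (α : Fin (d + 1)) (y : Site (d + 1)) :
    ∑ β, (lin4 c K N T κ u κ' u' x' (y - unitVec β) (Sum.inl α) (Sum.inl β) - lin4 c K N T κ u κ' u' x' y (Sum.inl α) (Sum.inl β))
      = -(c * cH) * ∑ v ∈ box (d + 1) N, ∑ κ₂,
          (comp K (vsym K N T κ u κ' u') ((N : ℤ) • x') ((N : ℤ) • y + toSite v - unitVec κ₂) (Sum.inr α) (Sum.inl κ₂)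
            - comp K (vsym K N T κ u κ' u') ((N : ℤ) • x') ((N : ℤ) • y + toSite v) (Sum.inr α) (Sum.inl κ₂)) := by
  -- the bounded class: `vsym T` bounded (leaf-01), hence `K ∘ vsym T` bounded
  have hV : Bdd (vsym K N T κ u κ' u') _ := fun x z a b => abs_vsym_le hK hδ N hT κ u κ' u' x z a b
  have hA : Bdd (comp K (vsym K N T κ u κ' u')) _ := Lin4Additive.bdd_comp_decays_bdd hK hδ hV
  -- the output entries are the multiplier legs of the sandwich at coarse points
  have e : ∀ z' : Site (d + 1), ∀ β : Fin (d + 1), lin4 c K N T κ u κ' u' x' z' (Sum.inl α) (Sum.inl β)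
      = -(c * comp (comp K (vsym K N T κ u κ' u')) K ((N : ℤ) • x') ((N : ℤ) • z') (Sum.inr α) (Sum.inr β)) := by
    intro z' β
    rw [lin4_apply]
    simp only [Pi.neg_apply, Pi.smul_apply, smul_eq_mul, mmRead_inl_inl]
  have key : ∑ β, (comp (comp K (vsym K N T κ u κ' u')) K ((N : ℤ) • x') ((N : ℤ) • (y - unitVec β)) (Sum.inr α) (Sum.inr β)
      - comp (comp K (vsym K N T κ u κ' u')) K ((N : ℤ) • x') ((N : ℤ) • y) (Sum.inr α) (Sum.inr β))
      = cH * ∑ v ∈ box (d + 1) N, ∑ κ₂,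
          (comp K (vsym K N T κ u κ' u') ((N : ℤ) • x') ((N : ℤ) • y + toSite v - unitVec κ₂) (Sum.inr α) (Sum.inl κ₂)
            - comp K (vsym K N T κ u κ' u') ((N : ℤ) • x') ((N : ℤ) • y + toSite v) (Sum.inr α) (Sum.inl κ₂)) := by
    rw [row_comp_ward_of_bdd hA hK hδ cH hH hMf ((N : ℤ) • x') (Sum.inr α) y,
      tsum_mul_gaugeWt_eq_boxSum hN (fun κ₂ x₂ => comp K (vsym K N T κ u κ' u') ((N : ℤ) • x') x₂ (Sum.inr α) (Sum.inl κ₂)) y]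
  have e4 : ∑ β, (lin4 c K N T κ u κ' u' x' (y - unitVec β) (Sum.inl α) (Sum.inl β) - lin4 c K N T κ u κ' u' x' y (Sum.inl α) (Sum.inl β))
      = -c * ∑ β, (comp (comp K (vsym K N T κ u κ' u')) K ((N : ℤ) • x') ((N : ℤ) • (y - unitVec β)) (Sum.inr α) (Sum.inr β)
          - comp (comp K (vsym K N T κ u κ' u')) K ((N : ℤ) • x') ((N : ℤ) • y) (Sum.inr α) (Sum.inr β)) := by
    rw [Finset.mul_sum]
    exact Finset.sum_congr rfl fun β _ => by rw [e, e]; ring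
  rw [e4, key]
  ring

/-- [folklore] **… WITH THE LEFT RESOLVENT PULLED OUT** of the block sum: `= −(c·c_H) · Σ′_w Σ_f K (N•x′) w (inr α) f · Σ_v Σ_{κ₂} Δ^{fine}_{κ₂} (vsym …)(w, N•y+v; f, inl κ₂)`
(slices summable: `K` decays, `vsym T` bounded by leaf-01's `abs_vsym_le`). -/
theorem legDiv_lin4_right_inner (hK : Decays K C δ) (hδ : 0 < δ) (hN : 1 ≤ N) (c : ℝ) (hT : ∀ κ u κ' u' x z a b, |T κ u κ' u' x z a b| ≤ B)
    (hH : ∀ (y : Site (d + 1)) (κ : Fin (d + 1)) (u : Site (d + 1)),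
      ∑ μ, (colH K N μ (y - unitVec μ) κ u - colH K N μ y κ u) = cH * gaugeWt N y κ u)
    (hMf : ∀ (y x₂ : Site (d + 1)) (ρ : Fin (d + 1)),
      ∑ μ, (K x₂ ((N : ℤ) • (y - unitVec μ)) (Sum.inr ρ) (Sum.inr μ) - K x₂ ((N : ℤ) • y) (Sum.inr ρ) (Sum.inr μ)) = 0)
    (κ : Fin (d + 1)) (u : Site (d + 1)) (κ' : Fin (d + 1)) (u' : Site (d + 1)) (x' : Site (d + 1)) (α : Fin (d + 1)) (y : Site (d + 1)) :
    ∑ β, (lin4 c K N T κ u κ' u' x' (y - unitVec β) (Sum.inl α) (Sum.inl β) - lin4 c K N T κ u κ' u' x' y (Sum.inl α) (Sum.inl β))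
      = -(c * cH) * ∑' w, ∑ f, K ((N : ℤ) • x') w (Sum.inr α) f * ∑ v ∈ box (d + 1) N, ∑ κ₂,
          (vsym K N T κ u κ' u' w ((N : ℤ) • y + toSite v - unitVec κ₂) f (Sum.inl κ₂)
            - vsym K N T κ u κ' u' w ((N : ℤ) • y + toSite v) f (Sum.inl κ₂)) := by
  have hV : Bdd (vsym K N T κ u κ' u') _ := fun x z a b => abs_vsym_le hK hδ N hT κ u κ' u' x z a b
  have hs : ∀ (z : Site (d + 1)) (b : Fib d), Summable fun w => ∑ f, K ((N : ℤ) • x') w (Sum.inr α) f * vsym K N T κ u κ' u' w z f b :=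
    fun z b => summable_slices_decays_bdd hK hδ hV ((N : ℤ) • x') z (Sum.inr α) b
  rw [legDiv_lin4_right hK hδ hN c hT hH hMf κ u κ' u' x' α y]
  congr 1
  -- each block term is a difference of two slices of `K ∘ V`; pull the finite sums inside the `w`-series
  symm
  have e1 : ∀ w : Site (d + 1), (∑ f, K ((N : ℤ) • x') w (Sum.inr α) f * ∑ v ∈ box (d + 1) N, ∑ κ₂,
        (vsym K N T κ u κ' u' w ((N : ℤ) • y + toSite v - unitVec κ₂) f (Sum.inl κ₂) - vsym K N T κ u κ' u' w ((N : ℤ) • y + toSite v) f (Sum.inl κ₂)))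
      = ∑ v ∈ box (d + 1) N, ∑ κ₂, ((∑ f, K ((N : ℤ) • x') w (Sum.inr α) f * vsym K N T κ u κ' u' w ((N : ℤ) • y + toSite v - unitVec κ₂) f (Sum.inl κ₂))
          - ∑ f, K ((N : ℤ) • x') w (Sum.inr α) f * vsym K N T κ u κ' u' w ((N : ℤ) • y + toSite v) f (Sum.inl κ₂)) := by
    intro w
    simp only [Finset.mul_sum, mul_sub]
    rw [Finset.sum_comm]
    refine Finset.sum_congr rfl fun v _ => ?_
    rw [Finset.sum_comm]
    refine Finset.sum_congr rfl fun κ₂ _ => ?_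
    rw [Finset.sum_sub_distrib]
  rw [tsum_congr e1, Summable.tsum_finsetSum (fun v _ => summable_sum fun κ₂ _ => (hs _ _).sub (hs _ _))]
  refine Finset.sum_congr rfl fun v _ => ?_
  rw [Summable.tsum_finsetSum (fun κ₂ _ => (hs _ _).sub (hs _ _))]
  refine Finset.sum_congr rfl fun κ₂ _ => ?_
  rw [(hs _ _).tsum_sub (hs _ _)]
  simp only [ExpKernelCalculus.comp]

end Lin

section Left

variable {K : MKer (d + 1) (Fib d)} {C δ : ℝ} {T : Fin (d + 1) → (Fin (d + 1) → ℤ) → Fin (d + 1) → (Fin (d + 1) → ℤ) → MKer (d + 1) (Fib d)}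
  {B : ℝ} {cH' : ℝ}

/-- [folklore] **ASSOCIATIVITY OF THE BOUNDED SANDWICH** `K ∘ (V ∘ K) = (K ∘ V) ∘ K` (decaying `K`, bounded `V`; pv's `comp_assoc_of_bound`). -/
theorem comp_assoc_dbd (hK : Decays K C δ) (hδ : 0 < δ) {V : MKer (d + 1) (Fib d)} {BV : ℝ} (hV : Bdd V BV) :
    comp K (comp V K) = comp (comp K V) K := by
  have hC : 0 ≤ C := hK.nonneg (Sum.inl 0)
  have hBV : 0 ≤ BV := (abs_nonneg _).trans (hV 0 0 (Sum.inl 0) (Sum.inl 0))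
  refine KernelWard.comp_assoc_of_bound fun x w a b => ⟨fun y => C * Real.exp (-δ * B12Sec2to5.l1 (x - y)),
    fun z => BV * (C * Real.exp (-δ * B12Sec2to5.l1 (z - w))), (ExpKernelCalculus.summable_exp_shift hδ x).mul_left C,
    ((summable_exp_shift' hδ w).mul_left C).mul_left BV, fun y => by positivity, fun z => by positivity, fun y z f g => ?_⟩
  rw [abs_mul, abs_mul]
  calc |K x y a f| * |V y z f g| * |K z w g b|
      ≤ (C * Real.exp (-δ * B12Sec2to5.l1 (x - y))) * BV * (C * Real.exp (-δ * B12Sec2to5.l1 (z - w))) :=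
        mul_le_mul (mul_le_mul (hK x y a f) (hV y z f g) (abs_nonneg _) (by positivity)) (hK z w g b) (abs_nonneg _) (by positivity)
    _ = _ := by ring

/-- [folklore] **T-EQ, LEFT LEG SLOT** — the mirror of `legDiv_lin4_right` through the transpose `trK`, under the laws (hH′) (constant `c_H′`) and
(hM♯′) for `trK K` (for the wall's `G_j`: `trK G_j = sgnK G_j`, `c_H′ = −c_H`, §3): the LEFT resolvent factor is replaced by the block sum of the fine
backward divergence of the LEFT field leg of `vsym T ∘ K` (written through `trK`). -/
theorem legDiv_lin4_left (hK : Decays K C δ) (hδ : 0 < δ) (hN : 1 ≤ N) (c : ℝ) (hT : ∀ κ u κ' u' x z a b, |T κ u κ' u' x z a b| ≤ B)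
    (hH' : ∀ (y : Site (d + 1)) (κ : Fin (d + 1)) (u : Site (d + 1)),
      ∑ μ, (colH (trK K) N μ (y - unitVec μ) κ u - colH (trK K) N μ y κ u) = cH' * gaugeWt N y κ u)
    (hMf' : ∀ (y x₂ : Site (d + 1)) (ρ : Fin (d + 1)),
      ∑ μ, (trK K x₂ ((N : ℤ) • (y - unitVec μ)) (Sum.inr ρ) (Sum.inr μ) - trK K x₂ ((N : ℤ) • y) (Sum.inr ρ) (Sum.inr μ)) = 0)
    (κ : Fin (d + 1)) (u : Site (d + 1)) (κ' : Fin (d + 1)) (u' : Site (d + 1)) (z' : Site (d + 1)) (β : Fin (d + 1)) (y : Site (d + 1)) :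
    ∑ α, (lin4 c K N T κ u κ' u' (y - unitVec α) z' (Sum.inl α) (Sum.inl β) - lin4 c K N T κ u κ' u' y z' (Sum.inl α) (Sum.inl β))
      = -(c * cH') * ∑ v ∈ box (d + 1) N, ∑ κ₂,
          (comp (trK K) (trK (vsym K N T κ u κ' u')) ((N : ℤ) • z') ((N : ℤ) • y + toSite v - unitVec κ₂) (Sum.inr β) (Sum.inl κ₂)
            - comp (trK K) (trK (vsym K N T κ u κ' u')) ((N : ℤ) • z') ((N : ℤ) • y + toSite v) (Sum.inr β) (Sum.inl κ₂)) := by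
  have hV : Bdd (vsym K N T κ u κ' u') _ := fun x z a b => abs_vsym_le hK hδ N hT κ u κ' u' x z a b
  -- the transposed kernel decays at the same rate and the transposed `vsym` is bounded by the same constant
  have hKt : Decays (trK K) C δ := fun x z a b => by
    rw [trK_apply, ExpKernelCalculus.l1_sub_symm]; exact hK z x b a
  have hVt : Bdd (trK (vsym K N T κ u κ' u')) _ := fun x z a b => by rw [trK_apply]; exact hV z x b a
  have hA : Bdd (comp (trK K) (trK (vsym K N T κ u κ' u'))) _ := Lin4Additive.bdd_comp_decays_bdd hKt hδ hVt
  -- the sandwich, re-associated and transposed: `S x z a b = (trK K ∘ trK V ∘ trK K) z x b a` read as `((trK K ∘ trK V) ∘ trK K)`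
  have eS : comp (comp K (vsym K N T κ u κ' u')) K = trK (comp (comp (trK K) (trK (vsym K N T κ u κ' u'))) (trK K)) := by
    rw [← comp_assoc_dbd hK hδ hV, trK_comp, trK_comp, TameKernelCalculus.trK_trK, TameKernelCalculus.trK_trK]
  have e : ∀ x' : Site (d + 1), ∀ α : Fin (d + 1), lin4 c K N T κ u κ' u' x' z' (Sum.inl α) (Sum.inl β)
      = -(c * comp (comp (trK K) (trK (vsym K N T κ u κ' u'))) (trK K) ((N : ℤ) • z') ((N : ℤ) • x') (Sum.inr β) (Sum.inr α)) := by
    intro x' α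
    rw [lin4_apply]
    simp only [Pi.neg_apply, Pi.smul_apply, smul_eq_mul, mmRead_inl_inl]
    rw [eS, trK_apply]
  have key : ∑ α, (comp (comp (trK K) (trK (vsym K N T κ u κ' u'))) (trK K) ((N : ℤ) • z') ((N : ℤ) • (y - unitVec α)) (Sum.inr β) (Sum.inr α)
      - comp (comp (trK K) (trK (vsym K N T κ u κ' u'))) (trK K) ((N : ℤ) • z') ((N : ℤ) • y) (Sum.inr β) (Sum.inr α))
      = cH' * ∑ v ∈ box (d + 1) N, ∑ κ₂,
          (comp (trK K) (trK (vsym K N T κ u κ' u')) ((N : ℤ) • z') ((N : ℤ) • y + toSite v - unitVec κ₂) (Sum.inr β) (Sum.inl κ₂)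
            - comp (trK K) (trK (vsym K N T κ u κ' u')) ((N : ℤ) • z') ((N : ℤ) • y + toSite v) (Sum.inr β) (Sum.inl κ₂)) := by
    rw [row_comp_ward_of_bdd hA hKt hδ cH' hH' hMf' ((N : ℤ) • z') (Sum.inr β) y,
      tsum_mul_gaugeWt_eq_boxSum hN (fun κ₂ x₂ => comp (trK K) (trK (vsym K N T κ u κ' u')) ((N : ℤ) • z') x₂ (Sum.inr β) (Sum.inl κ₂)) y]
  have e4 : ∑ α, (lin4 c K N T κ u κ' u' (y - unitVec α) z' (Sum.inl α) (Sum.inl β) - lin4 c K N T κ u κ' u' y z' (Sum.inl α) (Sum.inl β))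
      = -c * ∑ α, (comp (comp (trK K) (trK (vsym K N T κ u κ' u'))) (trK K) ((N : ℤ) • z') ((N : ℤ) • (y - unitVec α)) (Sum.inr β) (Sum.inr α)
          - comp (comp (trK K) (trK (vsym K N T κ u κ' u'))) (trK K) ((N : ℤ) • z') ((N : ℤ) • y) (Sum.inr β) (Sum.inr α)) := by
    rw [Finset.mul_sum]
    exact Finset.sum_congr rfl fun α _ => by rw [e, e]; ring
  rw [e4, key]
  ring

end Left

/-! ## §3 The comb ∕ wall instance -/

section Comb

variable {Lc : ℕ} [NeZero Lc] {r : Fin (d + 1) → ℕ}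

/-- [folklore] **(hM♯) FOR THE NORMALISED CO-DRESSED STEP RESOLVENT** (an1's `rowM_ward_coDressKBmAt_KInvStep`; the units multiply a zero):
`Σ_μ (K♮ᴱ_j x₂ (Lc•(y − e_μ)) (inr ρ) (inr μ) − K♮ᴱ_j x₂ (Lc•y) (inr ρ) (inr μ)) = 0`. -/
theorem hM_unitK_comb (j : ℕ) (y x₂ : Site (d + 1)) (ρ' : Fin (d + 1)) :
    ∑ μ, (unitK (sfStep Lc j) (smStep d Lc j) (coDressKBmAt (toSite r) Lc (KInvStep (d := d) Lc j)) x₂ ((Lc : ℤ) • (y - unitVec μ)) (Sum.inr ρ') (Sum.inr μ)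
        - unitK (sfStep Lc j) (smStep d Lc j) (coDressKBmAt (toSite r) Lc (KInvStep (d := d) Lc j)) x₂ ((Lc : ℤ) • y) (Sum.inr ρ') (Sum.inr μ)) = 0 := by
  simp only [unitK_apply, legScale_inr]
  have h := rowM_ward_coDressKBmAt_KInvStep (d := d) (Lc := Lc) (toSite r) j y x₂ ρ'
  have e : ∀ μ : Fin (d + 1), smStep d Lc j * coDressKBmAt (toSite r) Lc (KInvStep (d := d) Lc j) x₂ ((Lc : ℤ) • (y - unitVec μ)) (Sum.inr ρ') (Sum.inr μ) *
        smStep d Lc j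
      - smStep d Lc j * coDressKBmAt (toSite r) Lc (KInvStep (d := d) Lc j) x₂ ((Lc : ℤ) • y) (Sum.inr ρ') (Sum.inr μ) * smStep d Lc j
      = (smStep d Lc j * smStep d Lc j) * (coDressKBmAt (toSite r) Lc (KInvStep (d := d) Lc j) x₂ ((Lc : ℤ) • (y - unitVec μ)) (Sum.inr ρ') (Sum.inr μ)
          - coDressKBmAt (toSite r) Lc (KInvStep (d := d) Lc j) x₂ ((Lc : ℤ) • y) (Sum.inr ρ') (Sum.inr μ)) := fun μ => by ring
  simp only [e, ← Finset.mul_sum, h, mul_zero]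

/-- [folklore] **T-EQ, RIGHT LEG SLOT, FOR THE DRESSED COMB STEP** (every `j`, every in-block root `r`, every bounded `T`, any `c`; `c_H = (Lc^{d+1})⁻¹` j-free):
the coarse divergence of the right kernel leg of `lin4 c K♮ᴱ_j Lc T κ u κ′ u′` at row `(x′, α)` and site `y` is `−(c·(Lc^{d+1})⁻¹) ×` the block sum over `B(y)` of the
fine backward divergence of the right field leg of `K♮ᴱ_j ∘ vsym K♮ᴱ_j Lc T κ u κ′ u′`. -/
theorem legDiv_lin4_right_comb (hr : r ∈ box (d + 1) Lc) (j : ℕ) (c : ℝ)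
    {T : Fin (d + 1) → (Fin (d + 1) → ℤ) → Fin (d + 1) → (Fin (d + 1) → ℤ) → MKer (d + 1) (Fib d)} {B : ℝ}
    (hT : ∀ κ u κ' u' x z a b, |T κ u κ' u' x z a b| ≤ B)
    (κ : Fin (d + 1)) (u : Site (d + 1)) (κ' : Fin (d + 1)) (u' : Site (d + 1)) (x' : Site (d + 1)) (α : Fin (d + 1)) (y : Site (d + 1)) :
    ∑ β, (lin4 c (unitK (sfStep Lc j) (smStep d Lc j) (coDressKBmAt (toSite r) Lc (KInvStep (d := d) Lc j))) Lc T κ u κ' u' x' (y - unitVec β)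
          (Sum.inl α) (Sum.inl β)
        - lin4 c (unitK (sfStep Lc j) (smStep d Lc j) (coDressKBmAt (toSite r) Lc (KInvStep (d := d) Lc j))) Lc T κ u κ' u' x' y (Sum.inl α) (Sum.inl β))
      = -(c * ((Lc : ℝ) ^ (d + 1))⁻¹) * ∑ v ∈ box (d + 1) Lc, ∑ κ₂,
          (comp (unitK (sfStep Lc j) (smStep d Lc j) (coDressKBmAt (toSite r) Lc (KInvStep (d := d) Lc j)))
              (vsym (unitK (sfStep Lc j) (smStep d Lc j) (coDressKBmAt (toSite r) Lc (KInvStep (d := d) Lc j))) Lc T κ u κ' u')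
              ((Lc : ℤ) • x') ((Lc : ℤ) • y + toSite v - unitVec κ₂) (Sum.inr α) (Sum.inl κ₂)
            - comp (unitK (sfStep Lc j) (smStep d Lc j) (coDressKBmAt (toSite r) Lc (KInvStep (d := d) Lc j)))
              (vsym (unitK (sfStep Lc j) (smStep d Lc j) (coDressKBmAt (toSite r) Lc (KInvStep (d := d) Lc j))) Lc T κ u κ' u')
              ((Lc : ℤ) • x') ((Lc : ℤ) • y + toSite v) (Sum.inr α) (Sum.inl κ₂)) := by
  obtain ⟨δK, CK, hδK, -, hG⟩ := decays_coDressKBmAt_KInvStep (d := d) hr j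
  exact legDiv_lin4_right (decays_unitK hG) hδK (one_le_of_neZero Lc) c hT (hH_unitK_comb hr j) (hM_unitK_comb j) κ u κ' u' x' α y


/-- [folklore] **(hH′) FOR THE TRANSPOSE** of the normalised co-dressed step resolvent: by `trK G_j = sgnK G_j` (`BubbleParity`) its ℋ-columns are
MINUS those of `K♮ᴱ_j`, so (hH′) holds with `c_H′ = −(Lc^{d+1})⁻¹` (the OWNER's R7 (E0) «the ROW twin holds with the OPPOSITE sign»). -/
theorem hH_trK_unitK_comb (hr : r ∈ box (d + 1) Lc) (j : ℕ) (y : Site (d + 1)) (κ' : Fin (d + 1)) (u : Site (d + 1)) :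
    ∑ μ, (colH (trK (unitK (sfStep Lc j) (smStep d Lc j) (coDressKBmAt (toSite r) Lc (KInvStep (d := d) Lc j)))) Lc μ (y - unitVec μ) κ' u
        - colH (trK (unitK (sfStep Lc j) (smStep d Lc j) (coDressKBmAt (toSite r) Lc (KInvStep (d := d) Lc j)))) Lc μ y κ' u)
      = -((Lc : ℝ) ^ (d + 1))⁻¹ * gaugeWt Lc y κ' u := by
  have hG := trK_coDressKBmAt_KInvStep (d := d) hr j
  have e : ∀ (μ : Fin (d + 1)) (w : Site (d + 1)),
      colH (trK (unitK (sfStep Lc j) (smStep d Lc j) (coDressKBmAt (toSite r) Lc (KInvStep (d := d) Lc j)))) Lc μ w κ' u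
        = -colH (unitK (sfStep Lc j) (smStep d Lc j) (coDressKBmAt (toSite r) Lc (KInvStep (d := d) Lc j))) Lc μ w κ' u := by
    intro μ w
    simp only [colH, trK_apply, unitK_apply, legScale_inl, legScale_inr]
    have h := congrFun (congrFun (congrFun (congrFun hG u) ((Lc : ℤ) • w)) (Sum.inl κ')) (Sum.inr μ)
    rw [trK_apply, sgnK_apply, sgnF_inl, sgnF_inr] at h
    rw [h]
    ring
  calc ∑ μ, (colH (trK (unitK (sfStep Lc j) (smStep d Lc j) (coDressKBmAt (toSite r) Lc (KInvStep (d := d) Lc j)))) Lc μ (y - unitVec μ) κ' u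
          - colH (trK (unitK (sfStep Lc j) (smStep d Lc j) (coDressKBmAt (toSite r) Lc (KInvStep (d := d) Lc j)))) Lc μ y κ' u)
      = ∑ μ, -(colH (unitK (sfStep Lc j) (smStep d Lc j) (coDressKBmAt (toSite r) Lc (KInvStep (d := d) Lc j))) Lc μ (y - unitVec μ) κ' u
          - colH (unitK (sfStep Lc j) (smStep d Lc j) (coDressKBmAt (toSite r) Lc (KInvStep (d := d) Lc j))) Lc μ y κ' u) :=
        Finset.sum_congr rfl fun μ _ => by rw [e, e]; ring
    _ = -((( Lc : ℝ) ^ (d + 1))⁻¹ * gaugeWt Lc y κ' u) := by rw [Finset.sum_neg_distrib, hH_unitK_comb hr j y κ' u]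
    _ = _ := by ring

/-- [folklore] **(hM♯′) FOR THE TRANSPOSE**: the multiplier–multiplier entries are `sgnK`-even, so the transposed row law is the row law. -/
theorem hM_trK_unitK_comb (hr : r ∈ box (d + 1) Lc) (j : ℕ) (y x₂ : Site (d + 1)) (ρ' : Fin (d + 1)) :
    ∑ μ, (trK (unitK (sfStep Lc j) (smStep d Lc j) (coDressKBmAt (toSite r) Lc (KInvStep (d := d) Lc j))) x₂ ((Lc : ℤ) • (y - unitVec μ)) (Sum.inr ρ') (Sum.inr μ)
        - trK (unitK (sfStep Lc j) (smStep d Lc j) (coDressKBmAt (toSite r) Lc (KInvStep (d := d) Lc j))) x₂ ((Lc : ℤ) • y) (Sum.inr ρ') (Sum.inr μ)) = 0 := by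
  have hG := trK_coDressKBmAt_KInvStep (d := d) hr j
  have e : ∀ (w : Site (d + 1)) (μ : Fin (d + 1)),
      trK (unitK (sfStep Lc j) (smStep d Lc j) (coDressKBmAt (toSite r) Lc (KInvStep (d := d) Lc j))) x₂ w (Sum.inr ρ') (Sum.inr μ)
        = unitK (sfStep Lc j) (smStep d Lc j) (coDressKBmAt (toSite r) Lc (KInvStep (d := d) Lc j)) x₂ w (Sum.inr ρ') (Sum.inr μ) := by
    intro w μ
    simp only [trK_apply, unitK_apply, legScale_inr]
    have h := congrFun (congrFun (congrFun (congrFun hG x₂) w) (Sum.inr ρ')) (Sum.inr μ)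
    rw [trK_apply, sgnK_apply, sgnF_inr, sgnF_inr] at h
    rw [h]
    ring
  simp only [e]
  exact hM_unitK_comb j y x₂ ρ'

/-- [folklore] **T-EQ, LEFT LEG SLOT, FOR THE DRESSED COMB STEP** (every `j`, every in-block root, every bounded `T`, any `c`): the coarse divergence of the
LEFT kernel leg of `lin4 c K♮ᴱ_j Lc T κ u κ′ u′` at column `(z′, β)` and site `y` is `+(c·(Lc^{d+1})⁻¹) ×` the block sum of the fine backward divergence of
the left field leg of `vsym … ∘ K♮ᴱ_j` (through `trK`; sign `c_H′ = −c_H`). -/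
theorem legDiv_lin4_left_comb (hr : r ∈ box (d + 1) Lc) (j : ℕ) (c : ℝ)
    {T : Fin (d + 1) → (Fin (d + 1) → ℤ) → Fin (d + 1) → (Fin (d + 1) → ℤ) → MKer (d + 1) (Fib d)} {B : ℝ}
    (hT : ∀ κ u κ' u' x z a b, |T κ u κ' u' x z a b| ≤ B)
    (κ : Fin (d + 1)) (u : Site (d + 1)) (κ' : Fin (d + 1)) (u' : Site (d + 1)) (z' : Site (d + 1)) (β : Fin (d + 1)) (y : Site (d + 1)) :
    ∑ α, (lin4 c (unitK (sfStep Lc j) (smStep d Lc j) (coDressKBmAt (toSite r) Lc (KInvStep (d := d) Lc j))) Lc T κ u κ' u' (y - unitVec α) z'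
          (Sum.inl α) (Sum.inl β)
        - lin4 c (unitK (sfStep Lc j) (smStep d Lc j) (coDressKBmAt (toSite r) Lc (KInvStep (d := d) Lc j))) Lc T κ u κ' u' y z' (Sum.inl α) (Sum.inl β))
      = -(c * -((Lc : ℝ) ^ (d + 1))⁻¹) * ∑ v ∈ box (d + 1) Lc, ∑ κ₂,
          (comp (trK (unitK (sfStep Lc j) (smStep d Lc j) (coDressKBmAt (toSite r) Lc (KInvStep (d := d) Lc j))))
              (trK (vsym (unitK (sfStep Lc j) (smStep d Lc j) (coDressKBmAt (toSite r) Lc (KInvStep (d := d) Lc j))) Lc T κ u κ' u'))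
              ((Lc : ℤ) • z') ((Lc : ℤ) • y + toSite v - unitVec κ₂) (Sum.inr β) (Sum.inl κ₂)
            - comp (trK (unitK (sfStep Lc j) (smStep d Lc j) (coDressKBmAt (toSite r) Lc (KInvStep (d := d) Lc j))))
              (trK (vsym (unitK (sfStep Lc j) (smStep d Lc j) (coDressKBmAt (toSite r) Lc (KInvStep (d := d) Lc j))) Lc T κ u κ' u'))
              ((Lc : ℤ) • z') ((Lc : ℤ) • y + toSite v) (Sum.inr β) (Sum.inl κ₂)) := by
  obtain ⟨δK, CK, hδK, -, hG⟩ := decays_coDressKBmAt_KInvStep (d := d) hr j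
  exact legDiv_lin4_left (decays_unitK hG) hδK (one_le_of_neZero Lc) c hT (hH_trK_unitK_comb hr j) (hM_trK_unitK_comb hr j) κ u κ' u' z' β y

end Comb


end Summit.QuantumFields.BalabanUV.Beta.GAN24.Lin4LegDivergence

end
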